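import Mathlib.Analysis.InnerProductSpace.PiL2
import Mathlib.Analysis.Normed.Operator.Bilinear
import Literature.Geometry.Lorentzian.Basic
import HarnessLib

/-!
# Stub `stub_hr_coneAlgebra` (HR-C) of crux `HawkingExtensionIsKerr`, line `SketchIdeator2`

Programme HR (horizon regularity), brick C (cone algebra).  In the causal null sandwich one
shoots straight chart segments with direction `y + λ L` where `L` is a null, future-directed
chart vector of the (chart-read) Lorentzian form `B` (`B(L, L) = 0`, `B(T, L) < 0`, `T` the chart
vector of the time orientation) and `y` is a chart vector of norm `≤ 1` lying strictly below the
null hyperplane `L^⊥` (`B(y, L) ≤ -μ`, `μ > 0`).  This file proves the linear algebra: there is a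
threshold `λ₀ = λ₀(B, L, T, μ) > 0` such that for every `λ ≥ λ₀` every such direction is FUTURE
TIMELIKE, `B(y + λL, y + λL) < 0` and `B(T, y + λL) < 0`.

Proof.  By symmetry and `B(L, L) = 0`,
`B(y + λL, y + λL) = B(y, y) + 2λ B(y, L) ≤ ‖B‖‖y‖² − 2λμ ≤ ‖B‖ − 2λμ`, and
`B(T, y + λL) = B(T, y) + λ B(T, L) ≤ ‖B‖‖T‖ + λ B(T, L)`; both right-hand sides are `≤ -1`
once `λ ≥ (‖B‖ + 1)/(2μ)` and `λ ≥ (‖B‖‖T‖ + 1)/(−B(T, L))`.  We take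
`λ₀ := 1 + (‖B‖ + 1)/(2μ) + (‖B‖‖T‖ + 1)/(−B(T, L))`.
-/

noncomputable section

set_option linter.dupNamespace false

namespace Summit.FinalStateConjecture.FinalStateConjecture.Theorems.HawkingExtensionIsKerr.SketchIdeator2

open Literature.Geometry.Lorentzian
open scoped Manifold ContDiff Topology

/-- **HR-C (cone algebra): tilting a vector of norm `≤ 1` lying strictly below a null hyperplane
by a large multiple of the null vector makes it future timelike.**  For a symmetric continuous
bilinear form `B` on `E4` with `B(L, L) = 0` and `B(T, L) < 0`, and `μ > 0`, there is `λ₀ > 0`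
such that for all `λ ≥ λ₀` and all `y` with `‖y‖ ≤ 1`, `B(y, L) ≤ -μ`:
`B(y + λL, y + λL) < 0` and `B(T, y + λL) < 0`
(`B(y + λL, y + λL) = B(y, y) + 2λ B(y, L) ≤ ‖B‖ − 2λμ`,
`B(T, y + λL) ≤ ‖B‖‖T‖ + λ B(T, L)`). -/
theorem stub_hr_coneAlgebra : ∀ (B : E4 →L[ℝ] E4 →L[ℝ] ℝ) (L T : E4) (μ : ℝ), (∀ a b : E4, B a b = B b a) → 0 < μ → B L L = 0 → B T L < 0 → ∃ lam₀ : ℝ, 0 < lam₀ ∧ ∀ lam : ℝ, lam₀ ≤ lam → ∀ y : E4, ‖y‖ ≤ 1 → B y L ≤ -μ → B (y + lam • L) (y + lam • L) < 0 ∧ B T (y + lam • L) < 0 := by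
  intro B L T μ hsym hμ hLL hTL
  -- the two thresholds and the explicit `λ₀`
  have hc : 0 < -B T L := neg_pos.mpr hTL
  have h2μ : 0 < 2 * μ := by positivity
  have hA : 0 ≤ (‖B‖ + 1) / (2 * μ) := div_nonneg (by positivity) h2μ.le
  have hC : 0 ≤ (‖B‖ * ‖T‖ + 1) / (-B T L) := div_nonneg (by positivity) hc.le
  refine ⟨1 + (‖B‖ + 1) / (2 * μ) + (‖B‖ * ‖T‖ + 1) / (-B T L), by positivity, ?_⟩
  intro lam hlam y hy hyL
  have hlam_pos : 0 < lam := by linarith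
  -- `λ` dominates both thresholds
  have h1 : ‖B‖ + 1 ≤ lam * (2 * μ) := by
    rw [← div_le_iff₀ h2μ]
    linarith
  have h2 : ‖B‖ * ‖T‖ + 1 ≤ lam * (-B T L) := by
    rw [← div_le_iff₀ hc]
    linarith
  -- operator-norm bounds, using `‖y‖ ≤ 1`
  have hy0 : 0 ≤ ‖y‖ := norm_nonneg y
  have hB0 : 0 ≤ ‖B‖ := norm_nonneg B
  have hT0 : 0 ≤ ‖T‖ := norm_nonneg T
  have hyy : B y y ≤ ‖B‖ := by
    have h := B.le_opNorm₂ y y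
    rw [Real.norm_eq_abs] at h
    have h' : ‖B‖ * ‖y‖ * ‖y‖ ≤ ‖B‖ := by
      calc ‖B‖ * ‖y‖ * ‖y‖ ≤ ‖B‖ * 1 * 1 := by gcongr
        _ = ‖B‖ := by ring
    exact (le_abs_self _).trans (h.trans h')
  have hTy : B T y ≤ ‖B‖ * ‖T‖ := by
    have h := B.le_opNorm₂ T y
    rw [Real.norm_eq_abs] at h
    have h' : ‖B‖ * ‖T‖ * ‖y‖ ≤ ‖B‖ * ‖T‖ := by
      calc ‖B‖ * ‖T‖ * ‖y‖ ≤ ‖B‖ * ‖T‖ * 1 := by gcongr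
        _ = ‖B‖ * ‖T‖ := by ring
    exact (le_abs_self _).trans (h.trans h')
  -- bilinear expansions
  have e1 : B (y + lam • L) (y + lam • L) = B y y + 2 * lam * B y L := by
    have hs := hsym L y
    simp only [map_add, map_smul, add_apply, smul_apply, smul_eq_mul]
    linear_combination lam * hs + lam * lam * hLL
  have e2 : B T (y + lam • L) = B T y + lam * B T L := by
    simp only [map_add, map_smul, smul_eq_mul]
  -- conclusion
  have hprod : lam * B y L ≤ lam * (-μ) := mul_le_mul_of_nonneg_left hyL hlam_pos.le
  constructor
  · rw [e1]
    nlinarith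
  · rw [e2]
    nlinarith

end Summit.FinalStateConjecture.FinalStateConjecture.Theorems.HawkingExtensionIsKerr.SketchIdeator2
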